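import Mathlib
import HarnessLib
import Summits.ValiantsHypothesis.ValiantsHypothesis.Theorems.LacunarySymmetroidMatrixDescartesProductPlusOneSwitchedWindow
import Summits.ValiantsHypothesis.ValiantsHypothesis.Theorems.LacunarySymmetroidMatrixDescartesProductPlusOneBalanceCount

/-!
# ValiantsHypothesis / LacunarySymmetroid — crux `MatrixDescartes` (stmt-ValiantsHypothesis-18050, V1),
# LINE (A) «product_plus_one», floor `OneChangeFloorK3`: NEARLY-SWITCHED pullers are top-weight monotone (every ratio)

Extension of ✓ `…ProductPlusOneSwitchedWindow` (top weight `x^{−q}`: `T_j = Ψ_j/x^{q−p}` decreasing for rows alongside their middle letter —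
in particular for SWITCHED incoherent rows of ANY age).  The top weight's only incoherent enemy is a puller FAR from its zero.  Quantitatively,
with `L_j = (q−p)·a_j + q·b_j·x^p + (3q−p)·c_j·x^q` (✓ `top_numerator_eq`: `(q−p)p·b_j g_j + x^p N_j² = p·b_j·L_j + q²c_j²x^{p}Z²`):

* `top_deriv_numerator_neg_of_nearSwitched` — an incoherent row (`a b < 0`, `c ≠ 0`) with `a_j·L_j(x) ≤ 0` («NEARLY SWITCHED»:
  `q|b|x^p + (3q−p)|c|x^q ≥ (q−p)|a|`, automatic once switched) is `T`-decreasing at `x`;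
* `top_term_deriv_neg'`, `hasDerivAt_top_neg_of_rows'`, `top_injective_of_rows'`, ★ `X_mul_derivative_no_two_zeros_of_middle'` — the
  window law (normalised chart) with the extended criterion (alongside the middle letter ∨ no middle letter ∨ nearly switched incoherent):
  no two zeros of `X·P′` on a zero-free window, ANY support;
* `nearSwitched_mono` — `a·L` is non-increasing in `x` for an incoherent no-dip row, so ★★ `euler_roots_late_le_of_nearSwitched`: in a PURE
  INCOHERENT company, beyond a point `U₀` at which EVERY row is nearly switched (each puller within the factor `((3r−1)/(r−1))^{1/p}` of its zero),
  `#{roots of eulerNumerator d a 0 in [U₀,∞)} ≤ 2m + 1` — young risers of any number allowed (the top weight ignores riser age).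

So the floor's residual enemy is sharpened to: a window holding a riser INSIDE its balance zone (bottom weight fails) together with a puller FAR
from its zero (`a_j L_j > 0`, top weight fails) and too many pullers for ✓ few-pullers / riser-mass.
HONEST FRAMING: a cell of the research floor; NOT `OneChangeFloorK3` / the stubs / `MatrixDescartes`; `VP ≠ VNP` is NOT proved.
No definitions, no named facts; Mathlib + the lane files.
-/

set_option linter.dupNamespace false

namespace Summit.ValiantsHypothesis.ValiantsHypothesis.Theorems.LacunarySymmetroidMatrixDescartes

namespace ProductPlusOne

open Polynomial Finset
open scoped BigOperators

/-! ### §1 Nearly switched ⇒ top-weight monotone -/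

/-- **Nearly-switched incoherent rows are `T`-decreasing** (`a b < 0`, `c ≠ 0`, `x > 0`,
`a·((q−p)a + q b x^p + (3q−p) c x^q) ≤ 0`): the top-weight derivative numerator is negative. [this file's lemma] -/
theorem top_deriv_numerator_neg_of_nearSwitched (a b c : ℝ) (e k : ℕ) {x : ℝ} (hx : 0 < x) (hab : a * b < 0) (hc : c ≠ 0)
    (hL : a * (((k : ℝ) + 1) * a + (e + k + 2 : ℝ) * b * x ^ (e + 1) + (3 * (e + k + 2 : ℝ) - (e + 1 : ℝ)) * c * x ^ (e + k + 2)) ≤ 0) :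
    x ^ (k + 1) * (((e + k + 2 : ℝ) * c * ((k + 1 : ℝ) * x ^ k)) * (a + b * x ^ (e + 1) + c * x ^ (e + k + 2))
        - ((e + 1 : ℝ) * b + (e + k + 2 : ℝ) * c * x ^ (k + 1))
          * (b * ((e + 1 : ℝ) * x ^ e) + c * ((e + k + 2 : ℝ) * x ^ (e + k + 1))))
      - ((k + 1 : ℝ) * x ^ k) * ((e + 1 : ℝ) * b + (e + k + 2 : ℝ) * c * x ^ (k + 1)) * (a + b * x ^ (e + 1) + c * x ^ (e + k + 2))
      < 0 := by
  rw [top_numerator_eq]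
  have hxk : 0 < x ^ k := pow_pos hx k
  set L := ((k : ℝ) + 1) * a + (e + k + 2 : ℝ) * b * x ^ (e + 1) + (3 * (e + k + 2 : ℝ) - (e + 1 : ℝ)) * c * x ^ (e + k + 2) with hLdef
  have hbL : 0 ≤ b * L := by
    have ha : a ≠ 0 := by rintro rfl; rw [zero_mul] at hab; exact lt_irrefl 0 hab
    have h1 : 0 ≤ (a * b) * (a * L) := mul_nonneg_of_nonpos_of_nonpos hab.le hL
    have h2 : (a * b) * (a * L) = a ^ 2 * (b * L) := by ring
    rw [h2] at h1
    by_contra hneg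
    push Not at hneg
    have : a ^ 2 * (b * L) < 0 := mul_neg_of_pos_of_neg (by positivity) hneg
    linarith
  have hid : (k + 1 : ℝ) * (e + 1 : ℝ) * (b * (a + b * x ^ (e + 1) + c * x ^ (e + k + 2)))
        + x ^ (e + 1) * ((e + 1 : ℝ) * b + (e + k + 2 : ℝ) * c * x ^ (k + 1)) ^ 2
      = (e + 1 : ℝ) * (b * L) + (e + k + 2 : ℝ) ^ 2 * c ^ 2 * x ^ (e + 1) * (x ^ (k + 1)) ^ 2 := by
    rw [hLdef]; ring
  have hpos : 0 < (k + 1 : ℝ) * (e + 1 : ℝ) * (b * (a + b * x ^ (e + 1) + c * x ^ (e + k + 2)))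
        + x ^ (e + 1) * ((e + 1 : ℝ) * b + (e + k + 2 : ℝ) * c * x ^ (k + 1)) ^ 2 := by
    rw [hid]
    have h1 : 0 ≤ (e + 1 : ℝ) * (b * L) := mul_nonneg (by positivity) hbL
    have h2 : 0 < (e + k + 2 : ℝ) ^ 2 * c ^ 2 * x ^ (e + 1) * (x ^ (k + 1)) ^ 2 := by positivity
    linarith
  linarith [mul_pos hxk hpos]

/-- **Extended top criterion per row**: alongside its middle letter (`b·g > 0`), or no middle letter (`b = 0`, `c ≠ 0`, `g ≠ 0`), or a nearly
switched incoherent row (`a b < 0`, `c ≠ 0`, `a·L ≤ 0`). [this file's lemma] -/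
theorem top_term_deriv_neg' (a b c : ℝ) (e k : ℕ) {x : ℝ} (hx : 0 < x) (hg : a + b * x ^ (e + 1) + c * x ^ (e + k + 2) ≠ 0)
    (hrow : 0 < b * (a + b * x ^ (e + 1) + c * x ^ (e + k + 2)) ∨ (b = 0 ∧ c ≠ 0 ∧ a + b * x ^ (e + 1) + c * x ^ (e + k + 2) ≠ 0) ∨
      (a * b < 0 ∧ c ≠ 0 ∧
        a * (((k : ℝ) + 1) * a + (e + k + 2 : ℝ) * b * x ^ (e + 1) + (3 * (e + k + 2 : ℝ) - (e + 1 : ℝ)) * c * x ^ (e + k + 2)) ≤ 0)) :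
    ((((e + k + 2 : ℝ) * c * ((k + 1 : ℝ) * x ^ k)) * (a + b * x ^ (e + 1) + c * x ^ (e + k + 2))
          - ((e + 1 : ℝ) * b + (e + k + 2 : ℝ) * c * x ^ (k + 1))
            * (b * ((e + 1 : ℝ) * x ^ e) + c * ((e + k + 2 : ℝ) * x ^ (e + k + 1))))
          / (a + b * x ^ (e + 1) + c * x ^ (e + k + 2)) ^ 2 * x ^ (k + 1)
        - ((e + 1 : ℝ) * b + (e + k + 2 : ℝ) * c * x ^ (k + 1)) / (a + b * x ^ (e + 1) + c * x ^ (e + k + 2))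
          * ((k + 1 : ℕ) * x ^ k)) / (x ^ (k + 1)) ^ 2 < 0 := by
  have hg2 : 0 < (a + b * x ^ (e + 1) + c * x ^ (e + k + 2)) ^ 2 := by positivity
  have hden : 0 < (x ^ (k + 1)) ^ 2 := by positivity
  refine div_neg_of_neg_of_pos ?_ hden
  have hkey : x ^ (k + 1) * (((e + k + 2 : ℝ) * c * ((k + 1 : ℝ) * x ^ k)) * (a + b * x ^ (e + 1) + c * x ^ (e + k + 2))
        - ((e + 1 : ℝ) * b + (e + k + 2 : ℝ) * c * x ^ (k + 1))
          * (b * ((e + 1 : ℝ) * x ^ e) + c * ((e + k + 2 : ℝ) * x ^ (e + k + 1))))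
      - ((k + 1 : ℝ) * x ^ k) * ((e + 1 : ℝ) * b + (e + k + 2 : ℝ) * c * x ^ (k + 1)) * (a + b * x ^ (e + 1) + c * x ^ (e + k + 2))
      < 0 := by
    rcases hrow with h | h | ⟨hab, hc, hL⟩
    · exact top_deriv_numerator_neg a b c e k hx (Or.inl h)
    · exact top_deriv_numerator_neg a b c e k hx (Or.inr h)
    · exact top_deriv_numerator_neg_of_nearSwitched a b c e k hx hab hc hL
  have hid : (((e + k + 2 : ℝ) * c * ((k + 1 : ℝ) * x ^ k)) * (a + b * x ^ (e + 1) + c * x ^ (e + k + 2))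
          - ((e + 1 : ℝ) * b + (e + k + 2 : ℝ) * c * x ^ (k + 1))
            * (b * ((e + 1 : ℝ) * x ^ e) + c * ((e + k + 2 : ℝ) * x ^ (e + k + 1))))
          / (a + b * x ^ (e + 1) + c * x ^ (e + k + 2)) ^ 2 * x ^ (k + 1)
        - ((e + 1 : ℝ) * b + (e + k + 2 : ℝ) * c * x ^ (k + 1)) / (a + b * x ^ (e + 1) + c * x ^ (e + k + 2))
          * ((k + 1 : ℕ) * x ^ k)
      = (x ^ (k + 1) * (((e + k + 2 : ℝ) * c * ((k + 1 : ℝ) * x ^ k)) * (a + b * x ^ (e + 1) + c * x ^ (e + k + 2))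
          - ((e + 1 : ℝ) * b + (e + k + 2 : ℝ) * c * x ^ (k + 1))
            * (b * ((e + 1 : ℝ) * x ^ e) + c * ((e + k + 2 : ℝ) * x ^ (e + k + 1))))
        - ((k + 1 : ℝ) * x ^ k) * ((e + 1 : ℝ) * b + (e + k + 2 : ℝ) * c * x ^ (k + 1)) * (a + b * x ^ (e + 1) + c * x ^ (e + k + 2)))
        / (a + b * x ^ (e + 1) + c * x ^ (e + k + 2)) ^ 2 := by
    push_cast
    field_simp
  rw [hid]
  exact div_neg_of_neg_of_pos hkey hg2

/-! ### §2 The sum, Rolle, and the window law under the extended criterion -/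

/-- **`(Σ_j Ψ_j / y^{k+1})′ < 0`** under the extended top criterion (`m ≥ 1`, `x > 0`, no factor vanishing). [this file's theorem] -/
theorem hasDerivAt_top_neg_of_rows' {m : ℕ} (hm : 0 < m) (a b c : Fin m → ℝ) (e k : ℕ) {x : ℝ} (hx : 0 < x)
    (hg : ∀ j, a j + b j * x ^ (e + 1) + c j * x ^ (e + k + 2) ≠ 0)
    (hrow : ∀ j, 0 < b j * (a j + b j * x ^ (e + 1) + c j * x ^ (e + k + 2)) ∨
      (b j = 0 ∧ c j ≠ 0 ∧ a j + b j * x ^ (e + 1) + c j * x ^ (e + k + 2) ≠ 0) ∨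
      (a j * b j < 0 ∧ c j ≠ 0 ∧ a j * (((k : ℝ) + 1) * a j + (e + k + 2 : ℝ) * b j * x ^ (e + 1)
        + (3 * (e + k + 2 : ℝ) - (e + 1 : ℝ)) * c j * x ^ (e + k + 2)) ≤ 0)) :
    ∃ D : ℝ, D < 0 ∧ HasDerivAt (fun y : ℝ => ∑ j, (((e + 1 : ℝ) * b j + (e + k + 2 : ℝ) * c j * y ^ (k + 1))
        / (a j + b j * y ^ (e + 1) + c j * y ^ (e + k + 2))) / y ^ (k + 1)) D x := by
  refine ⟨∑ j, (((((e + k + 2 : ℝ) * c j * ((k + 1 : ℝ) * x ^ k)) * (a j + b j * x ^ (e + 1) + c j * x ^ (e + k + 2))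
          - ((e + 1 : ℝ) * b j + (e + k + 2 : ℝ) * c j * x ^ (k + 1))
            * (b j * ((e + 1 : ℝ) * x ^ e) + c j * ((e + k + 2 : ℝ) * x ^ (e + k + 1))))
          / (a j + b j * x ^ (e + 1) + c j * x ^ (e + k + 2)) ^ 2 * x ^ (k + 1)
        - ((e + 1 : ℝ) * b j + (e + k + 2 : ℝ) * c j * x ^ (k + 1)) / (a j + b j * x ^ (e + 1) + c j * x ^ (e + k + 2))
          * ((k + 1 : ℕ) * x ^ k)) / (x ^ (k + 1)) ^ 2), ?_, ?_⟩
  · refine Finset.sum_neg (fun j _ => ?_) ⟨⟨0, hm⟩, Finset.mem_univ _⟩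
    exact top_term_deriv_neg' (a j) (b j) (c j) e k hx (hg j) (hrow j)
  · exact HasDerivAt.fun_sum (u := Finset.univ) (fun j _ => hasDerivAt_top_term (a j) (b j) (c j) e k hx.ne' (hg j))

/-- **Rolle for the top-weighted sum under the extended criterion.** [this file's lemma] -/
theorem top_injective_of_rows' {m : ℕ} (hm : 0 < m) (a b c : Fin m → ℝ) (e k : ℕ) {w₁ w₂ : ℝ} (hw₁ : 0 < w₁) (hw : w₁ < w₂)
    (hfree : ∀ t ∈ Set.Icc w₁ w₂, ∀ j, a j + b j * t ^ (e + 1) + c j * t ^ (e + k + 2) ≠ 0)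
    (hrow : ∀ t ∈ Set.Icc w₁ w₂, ∀ j, 0 < b j * (a j + b j * t ^ (e + 1) + c j * t ^ (e + k + 2)) ∨
      (b j = 0 ∧ c j ≠ 0 ∧ a j + b j * t ^ (e + 1) + c j * t ^ (e + k + 2) ≠ 0) ∨
      (a j * b j < 0 ∧ c j ≠ 0 ∧ a j * (((k : ℝ) + 1) * a j + (e + k + 2 : ℝ) * b j * t ^ (e + 1)
        + (3 * (e + k + 2 : ℝ) - (e + 1 : ℝ)) * c j * t ^ (e + k + 2)) ≤ 0))
    (heq : (∑ j, (((e + 1 : ℝ) * b j + (e + k + 2 : ℝ) * c j * w₁ ^ (k + 1))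
        / (a j + b j * w₁ ^ (e + 1) + c j * w₁ ^ (e + k + 2))) / w₁ ^ (k + 1))
      = ∑ j, (((e + 1 : ℝ) * b j + (e + k + 2 : ℝ) * c j * w₂ ^ (k + 1))
        / (a j + b j * w₂ ^ (e + 1) + c j * w₂ ^ (e + k + 2))) / w₂ ^ (k + 1)) :
    False := by
  have hcont : ContinuousOn (fun y : ℝ => ∑ j, (((e + 1 : ℝ) * b j + (e + k + 2 : ℝ) * c j * y ^ (k + 1))
      / (a j + b j * y ^ (e + 1) + c j * y ^ (e + k + 2))) / y ^ (k + 1)) (Set.Icc w₁ w₂) := by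
    intro t ht
    obtain ⟨D, _, hD⟩ := hasDerivAt_top_neg_of_rows' hm a b c e k (hw₁.trans_le ht.1) (hfree t ht) (hrow t ht)
    exact hD.continuousAt.continuousWithinAt
  obtain ⟨ξ, hξ, hξ'⟩ := exists_deriv_eq_zero hw hcont heq
  obtain ⟨D, hDneg, hD⟩ := hasDerivAt_top_neg_of_rows' hm a b c e k (hw₁.trans hξ.1)
    (hfree ξ ⟨hξ.1.le, hξ.2.le⟩) (hrow ξ ⟨hξ.1.le, hξ.2.le⟩)
  rw [hD.deriv] at hξ'
  exact hDneg.ne hξ'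

/-- **Window law, normalised chart, extended top criterion.** [this file's theorem] -/
theorem X_mul_derivative_no_two_zeros_of_middle' {m : ℕ} (hm : 0 < m) (a b c : Fin m → ℝ) (e k : ℕ) {w₁ w₂ : ℝ}
    (hw₁ : 0 < w₁) (hw : w₁ < w₂)
    (hfree : ∀ t ∈ Set.Icc w₁ w₂, ∀ j, a j + b j * t ^ (e + 1) + c j * t ^ (e + k + 2) ≠ 0)
    (hrow : ∀ t ∈ Set.Icc w₁ w₂, ∀ j, 0 < b j * (a j + b j * t ^ (e + 1) + c j * t ^ (e + k + 2)) ∨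
      (b j = 0 ∧ c j ≠ 0 ∧ a j + b j * t ^ (e + 1) + c j * t ^ (e + k + 2) ≠ 0) ∨
      (a j * b j < 0 ∧ c j ≠ 0 ∧ a j * (((k : ℝ) + 1) * a j + (e + k + 2 : ℝ) * b j * t ^ (e + 1)
        + (3 * (e + k + 2 : ℝ) - (e + 1 : ℝ)) * c j * t ^ (e + k + 2)) ≤ 0))
    (h1 : eval w₁ (X * derivative (∏ j, (C (a j) + C (b j) * X ^ (e + 1) + C (c j) * X ^ (e + k + 2)))) = 0)
    (h2 : eval w₂ (X * derivative (∏ j, (C (a j) + C (b j) * X ^ (e + 1) + C (c j) * X ^ (e + k + 2)))) = 0) : False := by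
  have hz : ∀ w : ℝ, 0 < w → (∀ j, a j + b j * w ^ (e + 1) + c j * w ^ (e + k + 2) ≠ 0) →
      eval w (X * derivative (∏ j, (C (a j) + C (b j) * X ^ (e + 1) + C (c j) * X ^ (e + k + 2)))) = 0 →
      (∑ j, (((e + 1 : ℝ) * b j + (e + k + 2 : ℝ) * c j * w ^ (k + 1))
        / (a j + b j * w ^ (e + 1) + c j * w ^ (e + k + 2))) / w ^ (k + 1)) = 0 := by
    intro w hw0 hgw h0
    rw [← Finset.sum_div, psi_eq_zero_of_eval_X_mul_derivative a b c e k hw0 hgw h0, zero_div]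
  exact top_injective_of_rows' hm a b c e k hw₁ hw hfree hrow
    ((hz w₁ hw₁ (hfree w₁ ⟨le_rfl, hw.le⟩) h1).trans (hz w₂ (hw₁.trans hw) (hfree w₂ ⟨hw.le, le_rfl⟩) h2).symm)

/-! ### §3 The line's currency; the late count for pure incoherent companies -/

/-- **`a·L` is non-increasing** for an incoherent no-dip row (`a b < 0`, `a c < 0`): nearly switched at `u` ⇒ nearly switched at every `t ≥ u`.
[folklore] -/
theorem nearSwitched_mono (a b c : ℝ) (e k : ℕ) (hab : a * b < 0) (hac : a * c < 0) {u t : ℝ} (hu : 0 < u) (hut : u ≤ t)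
    (hL : a * (((k : ℝ) + 1) * a + (e + k + 2 : ℝ) * b * u ^ (e + 1) + (3 * (e + k + 2 : ℝ) - (e + 1 : ℝ)) * c * u ^ (e + k + 2)) ≤ 0) :
    a * (((k : ℝ) + 1) * a + (e + k + 2 : ℝ) * b * t ^ (e + 1) + (3 * (e + k + 2 : ℝ) - (e + 1 : ℝ)) * c * t ^ (e + k + 2)) ≤ 0 := by
  have h3 : (0 : ℝ) ≤ 3 * (e + k + 2 : ℝ) - (e + 1 : ℝ) := by
    have : (0 : ℝ) ≤ k := by positivity
    have : (0 : ℝ) ≤ e := by positivity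
    linarith
  have h1 : (e + k + 2 : ℝ) * (a * b) * t ^ (e + 1) ≤ (e + k + 2 : ℝ) * (a * b) * u ^ (e + 1) :=
    mul_le_mul_of_nonpos_left (pow_le_pow_left₀ hu.le hut _) (mul_nonpos_of_nonneg_of_nonpos (by positivity) hab.le)
  have h2 : (3 * (e + k + 2 : ℝ) - (e + 1 : ℝ)) * (a * c) * t ^ (e + k + 2)
      ≤ (3 * (e + k + 2 : ℝ) - (e + 1 : ℝ)) * (a * c) * u ^ (e + k + 2) :=
    mul_le_mul_of_nonpos_left (pow_le_pow_left₀ hu.le hut _) (mul_nonpos_of_nonneg_of_nonpos h3 hac.le)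
  nlinarith

/-- ★★ **LATE COUNT BY NEAR-SWITCHING** (pure incoherent company `a_{j0}a_{j1} < 0`, `a_{j0}a_{j2} < 0`, `K = 3`, bottom coupling, ANY support
`d 0 < d 1 < d 2`): if at `U₀ > 0` EVERY row is nearly switched,
`a_{j0}·((d₂−d₁)·a_{j0} + (d₂−d₀)·a_{j1}·U₀^{d₁−d₀} + (3(d₂−d₀) − (d₁−d₀))·a_{j2}·U₀^{d₂−d₀}) ≤ 0` (each remaining puller within the factor
`((3r−1)/(r−1))^{1/(d₁−d₀)}` of its zero; switched rows automatically), then `eulerNumerator d a 0` has at most `2m + 1` roots in `[U₀,∞)` —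
whatever the ages of the risers. [this file's theorem] -/
theorem euler_roots_late_le_of_nearSwitched {m : ℕ} (d : Fin 3 → ℕ) (h01 : d 0 < d 1) (h12 : d 1 < d 2)
    (a : Fin m → Fin 3 → ℝ) (hinc : ∀ j, a j 0 * a j 1 < 0 ∧ a j 0 * a j 2 < 0) {U₀ : ℝ} (hU : 0 < U₀)
    (hnear : ∀ j, a j 0 * ((((d 2 : ℝ) - d 1)) * a j 0 + ((d 2 : ℝ) - d 0) * a j 1 * U₀ ^ (d 1 - d 0)
      + (3 * ((d 2 : ℝ) - d 0) - ((d 1 : ℝ) - d 0)) * a j 2 * U₀ ^ (d 2 - d 0)) ≤ 0) :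
    ((∑ j, (∑ l, C (a j l * ((d l : ℝ) - d 0)) * X ^ (d l)) * ∏ i ∈ Finset.univ.erase j, (∑ l, C (a i l) * X ^ (d l))
        : ℝ[X]).roots.toFinset.filter (fun t => U₀ ≤ t)).card ≤ 2 * m + 1 := by
  classical
  rcases Nat.eq_zero_or_pos m with hm | hm
  · subst hm
    simp only [Finset.univ_eq_empty, Finset.sum_empty, roots_zero, Multiset.toFinset_zero, Finset.filter_empty,
      Finset.card_empty]
    exact Nat.zero_le _
  obtain ⟨e, he⟩ : ∃ e, d 1 = d 0 + e + 1 := ⟨d 1 - d 0 - 1, by omega⟩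
  obtain ⟨k, hk⟩ : ∃ k, d 2 = d 0 + e + k + 2 := ⟨d 2 - d 1 - 1, by omega⟩
  have he1 : d 1 - d 0 = e + 1 := by omega
  have hk2 : d 2 - d 0 = e + k + 2 := by omega
  have hp : ((d 1 : ℝ) - d 0) = (e + 1 : ℝ) := by rw [he]; push_cast; ring
  have hq : ((d 2 : ℝ) - d 0) = (e + k + 2 : ℝ) := by rw [hk]; push_cast; ring
  have hqp : ((d 2 : ℝ) - d 1) = ((k : ℝ) + 1) := by rw [hk, he]; push_cast; ring
  rw [eulerNumerator_eq d e k he hk a 0, sub_self, mul_zero, map_zero, zero_mul, sub_zero]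
  set P : ℝ[X] := ∏ j, (C (a j 0) + C (a j 1) * X ^ (e + 1) + C (a j 2) * X ^ (e + k + 2)) with hPdef
  have hac' : ∀ j, a j 0 * a j 2 < 0 := fun j => (hinc j).2
  have hP0 : P ≠ 0 := prod_trinomial_ne_zero (fun j => a j 0) (fun j => a j 1) (fun j => a j 2) e k hac'
  refine (card_roots_X_pow_mul_filter_le (m * d 0) (X * derivative P) (fun t => U₀ ≤ t) (fun t ht => (hU.trans_le ht).ne')).trans ?_
  have hZ : (P.roots.toFinset.filter (fun t => U₀ ≤ t)).card ≤ m := by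
    refine le_trans (card_le_card fun t ht => ?_)
      (prod_trinomial_pos_roots_le (fun j => a j 0) (fun j => a j 1) (fun j => a j 2) e k hac')
    rw [mem_filter] at ht ⊢
    exact ⟨ht.1, hU.trans_le ht.2⟩
  have hnear' : ∀ t : ℝ, U₀ ≤ t → ∀ j, a j 0 * (((k : ℝ) + 1) * a j 0 + (e + k + 2 : ℝ) * a j 1 * t ^ (e + 1)
      + (3 * (e + k + 2 : ℝ) - (e + 1 : ℝ)) * a j 2 * t ^ (e + k + 2)) ≤ 0 := by
    intro t hUt j
    have h := hnear j
    rw [hp, hq, hqp, he1, hk2] at h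
    exact nearSwitched_mono (a j 0) (a j 1) (a j 2) e k (hinc j).1 (hinc j).2 hU hUt h
  have h := roots_filter_le_of_windowLaw P (X * derivative P) hP0 (fun t => U₀ ≤ t)
    (fun z₁ _ t h₁ _ h₂ _ => h₁.trans h₂) m hZ (fun w₁ w₂ hw₁ _ hw hfree h1 h2 => ?_)
  · exact h.trans (by omega)
  · have hfree' : ∀ t ∈ Set.Icc w₁ w₂, ∀ j, a j 0 + a j 1 * t ^ (e + 1) + a j 2 * t ^ (e + k + 2) ≠ 0 := by
      intro t ht j hj
      apply hfree t ht
      rw [hPdef, eval_prod_trinomial, Finset.prod_eq_zero_iff]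
      exact ⟨j, mem_univ _, hj⟩
    have hc0 : ∀ j, a j 2 ≠ 0 := by
      intro j h0; have := (hinc j).2; rw [h0, mul_zero] at this; exact lt_irrefl 0 this
    exact X_mul_derivative_no_two_zeros_of_middle' hm (fun j => a j 0) (fun j => a j 1) (fun j => a j 2) e k
      (hU.trans_le hw₁) hw hfree'
      (fun t ht j => Or.inr (Or.inr ⟨(hinc j).1, hc0 j, hnear' t (hw₁.trans ht.1) j⟩)) h1 h2

end ProductPlusOne

end Summit.ValiantsHypothesis.ValiantsHypothesis.Theorems.LacunarySymmetroidMatrixDescartes
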